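import Summits.HodgeConjecture.HodgeConjecture.Theorems.F0P3cStCharTSWeylHypWIF        -- ★ p849936∕p849950 (a) «(WIF-σ)» + glue (this seat)
import Summits.HodgeConjecture.HodgeConjecture.Theorems.F0P3cStCharTSWeylHypJacobian   -- ★ p849811 (B-jac): tube Jacobian ⇒ weighted Weyl formula (this seat)
import Literature.MeasureTheory.Group.InvariantQuotientNormalized                        -- ★ `isInvInvariant_map_mulEquiv`
import HarnessLib

/-!
# F0 · P3c · line LH6 «StCharTS» — «(WIF) ⟸ JAC»: the leaf's Weyl-integration socket in DENSITY form, from the tube Jacobian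
# (Rogawski 1990 §12.5 p. 182; Harish-Chandra 1970 Lemmas 22 ∕ 42)

Cell `pub/hodgecm-mathlib`, crux H413 = `stmt-HodgeConjecture-24833` (lane `--supports`, helper); seat LH2-p02 (g3); item (b) of the integrator's word
(LH6-p01 (g2) 2026-09-02T06:31:37Z «ρ»: «build (a) first, then (b) … so that (WIF) of `…SaHeadTorus3` ⟸ JAC is a one-line corollary»).  Sequel of ★ p849811
(B-jac) and ★ p849936∕p849950 (a).  THEOREMS ONLY; sorry-free; no definition ∕ instance ∕ notation; axioms TRIO.  CONDITIONAL on the socket «JAC».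

THE SOCKET «JAC» (`hJac`, BY SHAPE; the one analytic input = the Jacobian of conjugation [HarishChandra1970, Lemma 22]; NOT in the tree): for THE Haar measure `tT`
of the split torus `T` with mass `1` on `compactCore T` (quantified `∀ tT, IsHaarMeasure → IsInvInvariant → tT(compactCore T) = 1 → …`, which pins it, ★
`eq_of_apply_compactCore_eq_one`), one measurable `A₀ ⊆ G ⧸ T` of positive finite `ν∕tT`-measure and a measurable weight `D : T → ℝ≥0` such that for every
measurable `W`-free `V ⊆ T^{reg}` the tube `{x t x⁻¹ | xT ∈ A₀, t ∈ V}` has Haar measure `(ν∕tT)(A₀) · ∫⁻_V D dtT` (Borel σ-algebra on `G ⧸ T` fixed inside).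

THE RESULT **`integral_mul_eq_integral_classOrbitalIntegral_density_of_tubeJacobian`** (`v` non-split; `ν` Haar on `G = U(Φ₃)(L⁺_v)`; `mQv` canonical; `μM` any
Haar measure on the parameter torus `M = E_vˣ × E¹_v`; `ι = torusChart L v`): under «JAC», for every measurable locally integrable `α` conjugation invariant on
`hyperbolicSet L v` and every `φ` with `IsLocSmooth φ`, `tsupport φ ⊆ hyperbolicSet L v`:
**`∫ φ·α dν = ∫_M classOrbitalIntegral mQv φ ⟦ι m⟧ · (ρ(m) · α(ι m)) dμM`,  `ρ m := (2 · c₀.toReal)⁻¹ · D(ι m)`,  `c₀ := (ι_* μM)(compactCore T)`** —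
a REAL density against `μM`, the shape of the leaf's (WIF) socket (★ p849901 `…SaHeadTorus3`) up to the integrator's unfolding
`torusTransform = (2 μM(M_c))⁻¹ · vanDijkWeight · classOrbitalIntegral` (★ p849564) — which needs `vanDijkWeight ∈ ℝ_{>0}` on `T^{reg}` («VDW-CORE»∕«SHELL-WEIGHT»,
LH2-p01 ∕ LH1-p03) and `c₀ = μM(M_c)` (`ι⁻¹(compactCore T) = M_c`); both are left to that edition, honestly.
Proof: `tm := ι_* μM` is a Haar measure on `T`, inversion invariant (`M` abelian); `c₀ = tm(compactCore T) ∈ (0, ∞)` (the core is compact open, ★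
`compactCore_centralizer_local_facts_of_isRegularElt` read on `T = Z(t₀)`); `tT := c₀⁻¹ • tm` is THE normalised measure; ★ p849811
`integral_hypSet_eq_of_tubeJacobian` at `tT` (tubes `Φ(A₀ × V)` = the Φ-free tubes of «JAC»); the inner fibre integral at a regular `t` is
`α(t) · classOrbitalIntegral mQv φ ⟦t⟧` (★ p849936 `classOrbitalIntegral_mk_eq_integral_conjFamily`); `tT`-a.e. `t` is regular (★ `ae_isUnit_torusEntry_sub_three`);
`∫ dtT = c₀⁻¹ ∫ dtm = c₀⁻¹ ∫_M ∘ι dμM` (★ `integral_comp_torusChart`).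

HONEST LABEL: count-neutral; CONDITIONAL on «JAC»; closes no organ.  HC_CM is proved only modulo the 7 printed citations (2 remaining: hLiu418 =
`stmt-HodgeConjecture-24832`, h413 = `stmt-HodgeConjecture-24833`) until rung 0 closes.

## References
* [Rogawski1990] J. D. Rogawski, *Automorphic Representations of Unitary Groups in Three Variables*, Ann. of Math. Stud. 123 (1990), §12.5 p. 182; §12.7 L. 12.7.2
  (proof) p. 193; §4.3 (4.3.1) p. 43.
* [HarishChandra1970] Harish-Chandra, *Harmonic analysis on reductive p-adic groups*, LNM 162 (1970), Lemma 22, Lemma 42.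
* [DeitmarEchterhoff2014] A. Deitmar, S. Echterhoff, *Principles of Harmonic Analysis*, 2nd ed. (2014), Thm. 1.5.3.
-/

set_option autoImplicit false
set_option linter.dupNamespace false

noncomputable section

open MeasureTheory Measure Set Filter Topology Function NumberField IsDedekindDomain Matrix Polynomial
open Literature.MeasureTheory.Group
open Literature.NumberTheory.Automorphic Literature.NumberTheory.Automorphic.UnitaryGroup Literature.NumberTheory.Rogawski1990
open Summit.HodgeConjecture.HodgeConjecture.Cruxes.H413.F0P3cStCharTSWeylHypFibre
open Summit.HodgeConjecture.HodgeConjecture.Cruxes.H413.F0P3cStCharTSWeylHypTorsor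
open Summit.HodgeConjecture.HodgeConjecture.Cruxes.H413.F0P3cStCharTSWeylHypCM
open Summit.HodgeConjecture.HodgeConjecture.Cruxes.H413.F0P3cStCharTSWeylHypMeasure
open Summit.HodgeConjecture.HodgeConjecture.Cruxes.H413.F0P3cStCharTSWeylHypJacobian
open Summit.HodgeConjecture.HodgeConjecture.Cruxes.H413.F0P3cStCharTSWeylHypWIF
open Summit.HodgeConjecture.HodgeConjecture.Cruxes.H413.F0P3cStCharTSTorusDefs
open Summit.HodgeConjecture.HodgeConjecture.Cruxes.H413.F0P3cStCharTSTorusChartIso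
open scoped ENNReal NNReal MatrixGroups Pointwise

namespace Summit.HodgeConjecture.HodgeConjecture.Cruxes.H413.F0P3cStCharTSWeylHypWIFJac

section CM

variable (L : Type) [Field L] [NumberField L] [IsCMField L] (v : HeightOneSpectrum (𝓞 ↥(maximalRealSubfield L)))

/-- **The compact core of the split torus `T` is compact and open** (every finite `v`): `T = Z(t₀)` for a regular `t₀ ∈ T` (★ (B0)) and ★
`compactCore_centralizer_local_facts_of_isRegularElt`. [cite: Rogawski1990, §4.3 (4.3.1) p. 43] -/
theorem isCompact_isOpen_compactCore_cmTorus :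
    IsCompact (compactCore ↥(cmBorelTriple L 3 v).M) ∧ IsOpen (compactCore ↥(cmBorelTriple L 3 v).M) := by
  obtain ⟨t₀, ht₀, hreg₀⟩ := exists_mem_torusU_isRegularElt L v
  have hZ : Subgroup.centralizer ({t₀} : Set ↥(unitaryGroupOfForm (conjLocal L (IsCMField.complexConj L) v) (cmLocalForm L 3 v))) = (cmBorelTriple L 3 v).M := centralizer_eq_cmTorus_of_isRegularElt L v ht₀ hreg₀
  have h : (∀ a b : ↥(Subgroup.centralizer ({t₀} : Set ↥(unitaryGroupOfForm (conjLocal L (IsCMField.complexConj L) v) (cmLocalForm L 3 v)))), a * b = b * a) ∧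
      IsCompact (compactCore ↥(Subgroup.centralizer ({t₀} : Set ↥(unitaryGroupOfForm (conjLocal L (IsCMField.complexConj L) v) (cmLocalForm L 3 v))))) ∧ IsOpen (compactCore ↥(Subgroup.centralizer ({t₀} : Set ↥(unitaryGroupOfForm (conjLocal L (IsCMField.complexConj L) v) (cmLocalForm L 3 v))))) :=
    compactCore_centralizer_local_facts_of_isRegularElt (IsCMField.complexConj L) 3 (Matrix.of fun i j : Fin 3 => if i.val + j.val + 1 = 3 then (1 : L) else 0) (IsCMField.complexConj_ne_one L)
      (antidiagOne_map_transpose (IsCMField.complexConj L) 3) (isUnit_antidiagOne_det L 3) t₀ hreg₀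
  rw [hZ] at h
  exact h.2

/-- **`tT`-almost every element of `T` is regular** (any Haar measure on `T`; ★ `ae_isUnit_torusEntry_sub_three` + ★ p849733 `isRegularElt_glDiagonal_of_isUnit_sub`).
[cite: Rogawski1990, §12.5 p. 183] [cite: HarishChandra1970, Lemma 42] -/
theorem ae_isRegularElt_cmTorus [MeasurableSpace ↥(unitaryGroupOfForm (conjLocal L (IsCMField.complexConj L) v) (cmLocalForm L 3 v))] [BorelSpace ↥(unitaryGroupOfForm (conjLocal L (IsCMField.complexConj L) v) (cmLocalForm L 3 v))] (μT : Measure ↥(cmBorelTriple L 3 v).M) [μT.IsHaarMeasure] :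
    ∀ᵐ t : ↥(cmBorelTriple L 3 v).M ∂μT, IsRegularElt (((t : ↥(unitaryGroupOfForm (conjLocal L (IsCMField.complexConj L) v) (cmLocalForm L 3 v)))) : GL (Fin 3) (LocalRing L v)) := by
  filter_upwards [ae_isUnit_torusEntry_sub_three L v μT] with t ht
  obtain ⟨d, hd⟩ := (mem_torusU_iff _).1 t.2
  have hdi : ∀ i, torusEntry (conjLocal L (IsCMField.complexConj L) v) (cmLocalForm L 3 v) i t = d i := fun i =>
    torusEntry_eq_of_glDiagonal_eq _ _ i t d hd
  rw [← hd]
  exact isRegularElt_glDiagonal_of_isUnit_sub fun i j hij => by rw [← hdi, ← hdi]; exact ht.1 i j hij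

set_option maxHeartbeats 1600000 in
set_option synthInstance.maxHeartbeats 400000 in
-- instance-term unification at the CM carrier (`quotientMeasure` ∕ canonical family), cf. ★ p849841
/-- **«(WIF) ⟸ JAC»: THE LEAF's WEYL-INTEGRATION SOCKET IN DENSITY FORM, FROM THE TUBE JACOBIAN** (`v` non-split; see the module docstring for the socket
«JAC» = `hJac` and the honest label).  For every Haar measure `μM` on `M = E_vˣ × E¹_v`, every measurable locally `ν`-integrable `α` conjugation invariant on
`hyperbolicSet L v` and every `φ` with `IsLocSmooth φ`, `tsupport φ ⊆ hyperbolicSet L v`: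
**`∫ φ·α dν = ∫_M classOrbitalIntegral mQv φ ⟦ι m⟧ · (ρ m · α(ι m)) dμM`, `ρ m = (2 · ((ι_*μM)(compactCore T)).toReal)⁻¹ · D(ι m)`** — ★ p849811 at THE normalised
torus measure `tT = c₀⁻¹ • ι_*μM`, ★ p849936 glue, ★ `ae_isUnit_torusEntry_sub_three`, ★ `integral_comp_torusChart`. [cite: Rogawski1990, §12.5 p. 182; §12.7 L. 12.7.2 (proof) p. 193]
[cite: HarishChandra1970, Lemma 22; Lemma 42] [cite: DeitmarEchterhoff2014, Thm. 1.5.3] -/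
theorem integral_mul_eq_integral_classOrbitalIntegral_density_of_tubeJacobian
    (hns : ∀ w : PlacesOver L v, IsCMField.complexConj L • w.1 = w.1)
    [MeasurableSpace ↥(unitaryGroupOfForm (conjLocal L (IsCMField.complexConj L) v) (cmLocalForm L 3 v))] [BorelSpace ↥(unitaryGroupOfForm (conjLocal L (IsCMField.complexConj L) v) (cmLocalForm L 3 v))] [LocallyCompactSpace ↥(unitaryGroupOfForm (conjLocal L (IsCMField.complexConj L) v) (cmLocalForm L 3 v))] [SecondCountableTopology ↥(unitaryGroupOfForm (conjLocal L (IsCMField.complexConj L) v) (cmLocalForm L 3 v))] [T2Space ↥(unitaryGroupOfForm (conjLocal L (IsCMField.complexConj L) v) (cmLocalForm L 3 v))]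
    [∀ γ : ↥(unitaryGroupOfForm (conjLocal L (IsCMField.complexConj L) v) (cmLocalForm L 3 v)), MeasurableSpace (↥(unitaryGroupOfForm (conjLocal L (IsCMField.complexConj L) v) (cmLocalForm L 3 v)) ⧸ Subgroup.centralizer ({γ} : Set ↥(unitaryGroupOfForm (conjLocal L (IsCMField.complexConj L) v) (cmLocalForm L 3 v))))] [∀ γ : ↥(unitaryGroupOfForm (conjLocal L (IsCMField.complexConj L) v) (cmLocalForm L 3 v)), BorelSpace (↥(unitaryGroupOfForm (conjLocal L (IsCMField.complexConj L) v) (cmLocalForm L 3 v)) ⧸ Subgroup.centralizer ({γ} : Set ↥(unitaryGroupOfForm (conjLocal L (IsCMField.complexConj L) v) (cmLocalForm L 3 v))))]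
    [MeasurableSpace ((LocalRing L v)ˣ × ↥(normOneUnits (conjLocal L (IsCMField.complexConj L) v)))] [BorelSpace ((LocalRing L v)ˣ × ↥(normOneUnits (conjLocal L (IsCMField.complexConj L) v)))]
    (ν : Measure ↥(unitaryGroupOfForm (conjLocal L (IsCMField.complexConj L) v) (cmLocalForm L 3 v))) [ν.IsHaarMeasure] [ν.IsMulRightInvariant]
    {mQv : OrbitalMeasureFamily ↥(unitaryGroupOfForm (conjLocal L (IsCMField.complexConj L) v) (cmLocalForm L 3 v))} (hcanQ : mQv.IsCanonical (fun γ => IsRegularElt (γ.val : GL (Fin 3) (LocalRing L v))) ν)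
    (μM : Measure ((LocalRing L v)ˣ × ↥(normOneUnits (conjLocal L (IsCMField.complexConj L) v)))) [μM.IsHaarMeasure]
    (w : ↥(unitaryGroupOfForm (conjLocal L (IsCMField.complexConj L) v) (cmLocalForm L 3 v))) (hw : Units.val (w : GL (Fin 3) (LocalRing L v)) = cmLocalForm L 3 v)
    (D : ↥(cmBorelTriple L 3 v).M → ℝ≥0) (hD : Measurable D)
    (hJac : letI : MeasurableSpace (↥(unitaryGroupOfForm (conjLocal L (IsCMField.complexConj L) v) (cmLocalForm L 3 v)) ⧸ (cmBorelTriple L 3 v).M) := borel _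
      haveI : BorelSpace (↥(unitaryGroupOfForm (conjLocal L (IsCMField.complexConj L) v) (cmLocalForm L 3 v)) ⧸ (cmBorelTriple L 3 v).M) := ⟨rfl⟩
      ∀ (tT : Measure ↥(cmBorelTriple L 3 v).M) (_ : tT.IsHaarMeasure) (_ : tT.IsInvInvariant), tT (compactCore ↥(cmBorelTriple L 3 v).M) = 1 →
        ∃ A₀ : Set (↥(unitaryGroupOfForm (conjLocal L (IsCMField.complexConj L) v) (cmLocalForm L 3 v)) ⧸ (cmBorelTriple L 3 v).M), MeasurableSet A₀ ∧
          quotientMeasure (cmBorelTriple L 3 v).M tT (isClosed_cmBorelTriple_M L v) ν A₀ ≠ 0 ∧ quotientMeasure (cmBorelTriple L 3 v).M tT (isClosed_cmBorelTriple_M L v) ν A₀ ≠ ∞ ∧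
          ∀ V : Set ↥(cmBorelTriple L 3 v).M, MeasurableSet V → (∀ t ∈ V, IsRegularElt (((t : ↥(unitaryGroupOfForm (conjLocal L (IsCMField.complexConj L) v) (cmLocalForm L 3 v)))) : GL (Fin 3) (LocalRing L v))) →
            (∀ t ∈ V, ∀ t' ∈ V, ((t' : ↥(cmBorelTriple L 3 v).M) : ↥(unitaryGroupOfForm (conjLocal L (IsCMField.complexConj L) v) (cmLocalForm L 3 v))) ≠ w * t * w⁻¹) →
              ν {y : ↥(unitaryGroupOfForm (conjLocal L (IsCMField.complexConj L) v) (cmLocalForm L 3 v)) | ∃ (x : ↥(unitaryGroupOfForm (conjLocal L (IsCMField.complexConj L) v) (cmLocalForm L 3 v))) (t : ↥(cmBorelTriple L 3 v).M), (QuotientGroup.mk x : ↥(unitaryGroupOfForm (conjLocal L (IsCMField.complexConj L) v) (cmLocalForm L 3 v)) ⧸ (cmBorelTriple L 3 v).M) ∈ A₀ ∧ t ∈ V ∧ y = x * t * x⁻¹} =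
                quotientMeasure (cmBorelTriple L 3 v).M tT (isClosed_cmBorelTriple_M L v) ν A₀ * ∫⁻ t in V, (D t : ℝ≥0∞) ∂tT) :
    ∀ α : ↥(unitaryGroupOfForm (conjLocal L (IsCMField.complexConj L) v) (cmLocalForm L 3 v)) → ℂ, Measurable α → LocallyIntegrable α ν →
      (∀ x : ↥(unitaryGroupOfForm (conjLocal L (IsCMField.complexConj L) v) (cmLocalForm L 3 v)), x ∈ (hyperbolicSet L v : Set ↥(unitaryGroupOfForm (conjLocal L (IsCMField.complexConj L) v) (cmLocalForm L 3 v))) → ∀ h : ↥(unitaryGroupOfForm (conjLocal L (IsCMField.complexConj L) v) (cmLocalForm L 3 v)), α (h * x * h⁻¹) = α x) →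
      ∀ φ : ↥(unitaryGroupOfForm (conjLocal L (IsCMField.complexConj L) v) (cmLocalForm L 3 v)) → ℂ, IsLocSmooth φ → tsupport φ ⊆ (hyperbolicSet L v : Set ↥(unitaryGroupOfForm (conjLocal L (IsCMField.complexConj L) v) (cmLocalForm L 3 v))) →
        ∫ x, φ x * α x ∂ν =
          ∫ m, classOrbitalIntegral mQv φ (ConjClasses.mk (((torusChart L v m : ↥(cmBorelTriple L 3 v).M) : ↥(unitaryGroupOfForm (conjLocal L (IsCMField.complexConj L) v) (cmLocalForm L 3 v))))) *
            ((((2 * ((μM.map (torusChart L v)) (compactCore ↥(cmBorelTriple L 3 v).M)).toReal)⁻¹ * (D (torusChart L v m) : ℝ) : ℝ) : ℂ) *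
              α ((torusChart L v m : ↥(cmBorelTriple L 3 v).M) : ↥(unitaryGroupOfForm (conjLocal L (IsCMField.complexConj L) v) (cmLocalForm L 3 v)))) ∂μM := by
  intro α hαm hαli hαinv φ hφ hsupp
  classical
  letI : MeasurableSpace (↥(unitaryGroupOfForm (conjLocal L (IsCMField.complexConj L) v) (cmLocalForm L 3 v)) ⧸ (cmBorelTriple L 3 v).M) := borel _
  haveI : BorelSpace (↥(unitaryGroupOfForm (conjLocal L (IsCMField.complexConj L) v) (cmLocalForm L 3 v)) ⧸ (cmBorelTriple L 3 v).M) := ⟨rfl⟩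
  have hT := isClosed_cmBorelTriple_M L v
  haveI := hT
  have hTc : ∀ a ∈ (cmBorelTriple L 3 v).M, ∀ b ∈ (cmBorelTriple L 3 v).M, a * b = b * a := fun a ha b hb => mul_comm_of_mem_torusU_cmLocal L v ha hb
  haveI : LocallyCompactSpace ↥(cmBorelTriple L 3 v).M := hT.isClosedEmbedding_subtypeVal.locallyCompactSpace
  haveI : SecondCountableTopology ↥(cmBorelTriple L 3 v).M := TopologicalSpace.Subtype.secondCountableTopology _
  -- §a the Haar measure `tm = ι_* μM` on `T`, the constant `c₀`, THE normalised measure `tT`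
  set tm : Measure ↥(cmBorelTriple L 3 v).M := μM.map (torusChart L v) with htm
  haveI : tm.IsHaarMeasure := isHaarMeasure_map_torusChart L v μM
  haveI := F0P3cStCharTSTorusRay.secondCountableTopology_torus L v
  haveI := F0P3cStCharTSTorusRay.locallyCompactSpace_torus L v
  haveI : μM.Regular := inferInstance
  haveI : μM.IsInvInvariant := inferInstance
  haveI : tm.IsInvInvariant := by
    rw [htm, ← coe_torusChartEquiv]
    exact isInvInvariant_map_mulEquiv (torusChartEquiv L v).toMulEquiv (torusChartEquiv L v).continuous.measurable μM
  obtain ⟨hcoreC, hcoreO⟩ := isCompact_isOpen_compactCore_cmTorus L v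
  set c₀ : ℝ≥0∞ := tm (compactCore ↥(cmBorelTriple L 3 v).M) with hc₀
  have hc0 : c₀ ≠ 0 := (hcoreO.measure_pos tm ⟨1, one_mem_compactCore⟩).ne'
  have hctop : c₀ ≠ ∞ := hcoreC.measure_lt_top.ne
  set tT : Measure ↥(cmBorelTriple L 3 v).M := c₀⁻¹ • tm with htT
  haveI : tT.IsHaarMeasure := Measure.IsHaarMeasure.smul tm (ENNReal.inv_ne_zero.2 hctop) (ENNReal.inv_ne_top.2 hc0)
  haveI : tT.IsInvInvariant := ⟨by rw [Measure.inv_def, htT, Measure.map_smul, ← Measure.inv_def, Measure.inv_eq_self]⟩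
  have htT1 : tT (compactCore ↥(cmBorelTriple L 3 v).M) = 1 := by
    rw [htT, Measure.smul_apply, smul_eq_mul, ENNReal.inv_mul_cancel hc0 hctop]
  -- §b the conjugation family; the socket at `tT` in ★ p849811's tube shape
  obtain ⟨Φ, hΦ⟩ := exists_conjFamily (cmBorelTriple L 3 v).M hTc
  obtain ⟨A₀, hA₀m, hA₀0, hA₀top, hJ⟩ := hJac tT inferInstance inferInstance htT1
  have htube : ∀ V : Set ↥(cmBorelTriple L 3 v).M, Φ '' (A₀ ×ˢ V) =
      {y : ↥(unitaryGroupOfForm (conjLocal L (IsCMField.complexConj L) v) (cmLocalForm L 3 v)) | ∃ (x : ↥(unitaryGroupOfForm (conjLocal L (IsCMField.complexConj L) v) (cmLocalForm L 3 v))) (t : ↥(cmBorelTriple L 3 v).M), (QuotientGroup.mk x : ↥(unitaryGroupOfForm (conjLocal L (IsCMField.complexConj L) v) (cmLocalForm L 3 v)) ⧸ (cmBorelTriple L 3 v).M) ∈ A₀ ∧ t ∈ V ∧ y = x * t * x⁻¹} := by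
    intro V
    ext y
    constructor
    · rintro ⟨⟨q, t⟩, ⟨hq, ht⟩, rfl⟩
      obtain ⟨x, rfl⟩ := QuotientGroup.mk_surjective q
      exact ⟨x, t, hq, ht, hΦ x t⟩
    · rintro ⟨x, t, hx, ht, rfl⟩
      exact ⟨(QuotientGroup.mk x, t), ⟨hx, ht⟩, hΦ x t⟩
  have hJac' : ∃ A₀ : Set (↥(unitaryGroupOfForm (conjLocal L (IsCMField.complexConj L) v) (cmLocalForm L 3 v)) ⧸ (cmBorelTriple L 3 v).M), MeasurableSet A₀ ∧
      quotientMeasure (cmBorelTriple L 3 v).M tT (isClosed_cmBorelTriple_M L v) ν A₀ ≠ 0 ∧ quotientMeasure (cmBorelTriple L 3 v).M tT (isClosed_cmBorelTriple_M L v) ν A₀ ≠ ∞ ∧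
      ∀ V : Set ↥(cmBorelTriple L 3 v).M, MeasurableSet V → (∀ t ∈ V, IsRegularElt (((t : ↥(unitaryGroupOfForm (conjLocal L (IsCMField.complexConj L) v) (cmLocalForm L 3 v)))) : GL (Fin 3) (LocalRing L v))) →
        (∀ t ∈ V, ∀ t' ∈ V, ((t' : ↥(cmBorelTriple L 3 v).M) : ↥(unitaryGroupOfForm (conjLocal L (IsCMField.complexConj L) v) (cmLocalForm L 3 v))) ≠ w * t * w⁻¹) →
          ν (Φ '' (A₀ ×ˢ V)) = quotientMeasure (cmBorelTriple L 3 v).M tT (isClosed_cmBorelTriple_M L v) ν A₀ * ∫⁻ t in V, (D t : ℝ≥0∞) ∂tT :=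
    ⟨A₀, hA₀m, hA₀0, hA₀top, fun V hVm hVreg hVfree => by rw [htube]; exact hJ V hVm hVreg hVfree⟩
  -- §c ★ p849811 (Bochner form) at `g := φ · α`
  have hΩ := hyperbolicSet_eq_hypSet L v
  have hint : IntegrableOn (fun x => φ x * α x) (hyperbolicSet L v : Set ↥(unitaryGroupOfForm (conjLocal L (IsCMField.complexConj L) v) (cmLocalForm L 3 v))) ν := by
    have h := hαli.integrable_smul_left_of_hasCompactSupport hφ.continuous hφ.hasCompactSupport
    simp only [smul_eq_mul] at h
    exact h.integrableOn
  have hφ0 : ∀ x : ↥(unitaryGroupOfForm (conjLocal L (IsCMField.complexConj L) v) (cmLocalForm L 3 v)), x ∉ (hyperbolicSet L v : Set ↥(unitaryGroupOfForm (conjLocal L (IsCMField.complexConj L) v) (cmLocalForm L 3 v))) → φ x = 0 := fun x hx => image_eq_zero_of_notMem_tsupport fun h => hx (hsupp h)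
  rw [hΩ] at hint hφ0
  obtain ⟨-, heq⟩ := integral_hypSet_eq_of_tubeJacobian L v hns ν tT Φ hΦ w hw D hD hJac' (fun x => φ x * α x) hint
  -- §d the inner fibre integral at a regular `t` is `α(t) · O^{can}_t(φ)`
  have hinner : ∀ t : ↥(cmBorelTriple L 3 v).M, IsRegularElt (((t : ↥(unitaryGroupOfForm (conjLocal L (IsCMField.complexConj L) v) (cmLocalForm L 3 v)))) : GL (Fin 3) (LocalRing L v)) →
      ∫ q, φ (Φ (q, t)) * α (Φ (q, t)) ∂(quotientMeasure (cmBorelTriple L 3 v).M tT (isClosed_cmBorelTriple_M L v) ν) =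
        classOrbitalIntegral mQv φ (ConjClasses.mk (t : ↥(unitaryGroupOfForm (conjLocal L (IsCMField.complexConj L) v) (cmLocalForm L 3 v)))) * α t := by
    intro t ht
    have htΩ : (t : ↥(unitaryGroupOfForm (conjLocal L (IsCMField.complexConj L) v) (cmLocalForm L 3 v))) ∈ {x | ∃ g t : ↥(unitaryGroupOfForm (conjLocal L (IsCMField.complexConj L) v) (cmLocalForm L 3 v)), t ∈ (cmBorelTriple L 3 v).M ∧ IsRegularElt (t : GL (Fin 3) (LocalRing L v)) ∧ g * t * g⁻¹ = x} := mem_hypSet_of_mem_torusU (conjLocal L (IsCMField.complexConj L) v) (cmLocalForm L 3 v) t.2 ht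
    rw [← hΩ] at htΩ
    have hpt : ∀ q, φ (Φ (q, t)) * α (Φ (q, t)) = φ (Φ (q, t)) * α t := by
      intro q
      induction q using QuotientGroup.induction_on with
      | H x => rw [hΦ, hαinv _ htΩ x]
    rw [integral_congr_ae (Eventually.of_forall hpt), integral_mul_const,
      classOrbitalIntegral_mk_eq_integral_conjFamily L v ν hcanQ tT htT1 Φ hΦ t ht φ hφ.continuous.measurable]
  -- §e assemble: `∫ φα = ½ ∫_{T^reg} D • (α · O) dtT = ½ ∫_T … dtT = ½ c₀⁻¹ ∫_M … ∘ ι dμM`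
  have hSm := (isOpen_setOf_isRegularElt_torusU (conjLocal L (IsCMField.complexConj L) v) (cmLocalForm L 3 v)
    (isUnit_of_ne_zero_of_nonsplit L v hns) (R := LocalRing L v)).measurableSet
  have h1 : ∫ x, φ x * α x ∂ν = ∫ x in {x | ∃ g t : ↥(unitaryGroupOfForm (conjLocal L (IsCMField.complexConj L) v) (cmLocalForm L 3 v)), t ∈ (cmBorelTriple L 3 v).M ∧ IsRegularElt (t : GL (Fin 3) (LocalRing L v)) ∧ g * t * g⁻¹ = x}, φ x * α x ∂ν :=
    (setIntegral_eq_integral_of_forall_compl_eq_zero fun x hx => by rw [hφ0 x hx, zero_mul]).symm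
  have h2 : ∫ t in {t : ↥(cmBorelTriple L 3 v).M | IsRegularElt (((t : ↥(unitaryGroupOfForm (conjLocal L (IsCMField.complexConj L) v) (cmLocalForm L 3 v)))) : GL (Fin 3) (LocalRing L v))},
      (D t : ℝ) • ∫ q, φ (Φ (q, t)) * α (Φ (q, t)) ∂(quotientMeasure (cmBorelTriple L 3 v).M tT (isClosed_cmBorelTriple_M L v) ν) ∂tT =
      ∫ t, (D t : ℝ) • (classOrbitalIntegral mQv φ (ConjClasses.mk (t : ↥(unitaryGroupOfForm (conjLocal L (IsCMField.complexConj L) v) (cmLocalForm L 3 v)))) * α t) ∂tT := by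
    have hae : ∀ᵐ t : ↥(cmBorelTriple L 3 v).M ∂tT, t ∈ {t : ↥(cmBorelTriple L 3 v).M | IsRegularElt (((t : ↥(unitaryGroupOfForm (conjLocal L (IsCMField.complexConj L) v) (cmLocalForm L 3 v)))) : GL (Fin 3) (LocalRing L v))} :=
      ae_isRegularElt_cmTorus L v tT
    rw [setIntegral_congr_fun hSm fun t ht => by rw [hinner t ht], Measure.restrict_eq_self_of_ae_mem hae]
  have h3 : (2 : ℝ) • ∫ x, φ x * α x ∂ν =
      ∫ t, (D t : ℝ) • (classOrbitalIntegral mQv φ (ConjClasses.mk (t : ↥(unitaryGroupOfForm (conjLocal L (IsCMField.complexConj L) v) (cmLocalForm L 3 v)))) * α t) ∂tT := by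
    rw [h1, ← heq, h2]
  have h4 : ∫ t, (D t : ℝ) • (classOrbitalIntegral mQv φ (ConjClasses.mk (t : ↥(unitaryGroupOfForm (conjLocal L (IsCMField.complexConj L) v) (cmLocalForm L 3 v)))) * α t) ∂tT =
      (c₀⁻¹).toReal • ∫ m, (D (torusChart L v m) : ℝ) •
        (classOrbitalIntegral mQv φ (ConjClasses.mk (((torusChart L v m : ↥(cmBorelTriple L 3 v).M) : ↥(unitaryGroupOfForm (conjLocal L (IsCMField.complexConj L) v) (cmLocalForm L 3 v))))) * α ((torusChart L v m : ↥(cmBorelTriple L 3 v).M) : ↥(unitaryGroupOfForm (conjLocal L (IsCMField.complexConj L) v) (cmLocalForm L 3 v)))) ∂μM := by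
    rw [htT, integral_smul_measure, htm, integral_comp_torusChart]
  calc ∫ x, φ x * α x ∂ν = (2 : ℝ)⁻¹ • ((2 : ℝ) • ∫ x, φ x * α x ∂ν) := by
        rw [smul_smul, inv_mul_cancel₀ (two_ne_zero' ℝ), one_smul]
    _ = (2 : ℝ)⁻¹ • ((c₀⁻¹).toReal • ∫ m, (D (torusChart L v m) : ℝ) •
          (classOrbitalIntegral mQv φ (ConjClasses.mk (((torusChart L v m : ↥(cmBorelTriple L 3 v).M) : ↥(unitaryGroupOfForm (conjLocal L (IsCMField.complexConj L) v) (cmLocalForm L 3 v))))) *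
            α ((torusChart L v m : ↥(cmBorelTriple L 3 v).M) : ↥(unitaryGroupOfForm (conjLocal L (IsCMField.complexConj L) v) (cmLocalForm L 3 v)))) ∂μM) := by rw [h3, h4]
    _ = ∫ m, (2 : ℝ)⁻¹ • ((c₀⁻¹).toReal • ((D (torusChart L v m) : ℝ) •
          (classOrbitalIntegral mQv φ (ConjClasses.mk (((torusChart L v m : ↥(cmBorelTriple L 3 v).M) : ↥(unitaryGroupOfForm (conjLocal L (IsCMField.complexConj L) v) (cmLocalForm L 3 v))))) *
            α ((torusChart L v m : ↥(cmBorelTriple L 3 v).M) : ↥(unitaryGroupOfForm (conjLocal L (IsCMField.complexConj L) v) (cmLocalForm L 3 v)))))) ∂μM := by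
        rw [← integral_smul, ← integral_smul]
    _ = _ := integral_congr_ae (Eventually.of_forall fun m => by
        simp only [Complex.real_smul, ENNReal.toReal_inv]
        push_cast
        ring)

end CM

end Summit.HodgeConjecture.HodgeConjecture.Cruxes.H413.F0P3cStCharTSWeylHypWIFJac
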